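import Literature.NumberTheory.EllipticCurves.PotentiallyMultiplicativeRamifiedTorsion
import Literature.NumberTheory.EllipticCurves.PointDivisibilityProofs
import HarnessLib

/-!
# Ramified `ℓ`-power torsion at a place with `|j|_v > 1`, for every prime `ℓ` (including `ℓ = 2`)

`Proofs` file (theorems only, no definitions, no named facts) in topic
`NumberTheory/EllipticCurves`, landed by the tenured seat of bsd.S15
(`Literature.NumberTheory.EllipticCurves.conductorNorm_eq_artinConductorNat`, `BSDConductor`).
It extends `TateFormReduction` / `PotentiallyMultiplicativeRamifiedTorsion` (Silverman, *AEC*,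
2nd ed., proof of Thm. VII.7.1, multiplicative case, PDF p. 179: *"the `ℓ`-torsion is `ℤ/ℓℤ` …
contradiction"*, made unconditional there by the torsion class count on the Tate form of
invariant `j` instead of the finiteness of `E(K^nr)/E₀(K^nr)`) from **odd** `n` to **all prime
powers `ℓᵏ`**, in particular to `2`-power torsion — the input needed to bound the inertia
invariants of the `2`-adic Tate module at a place of multiplicative reduction
(`InertiaInvariantsMultiplicativeProofs`).

* `TateForm.ncard_image_two_nsmul_le_of_torsion` — **the torsion class bound for the doubles**:
  for `M_L` in Tate form (`y² + xy = x³ + a₄x + a₆`, `|a₄| ≤ |a₆| = cᴺ < 1`) over a valued field,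
  `|n| = 1` (no parity assumption) and a finite `n`-torsion subgroup `G ≤ M(L)` with integral
  levels, `#{2P : P ∈ G} ≤ n(2N + 1)`.  In `TateForm.ncard_le_of_torsion` (odd `n`) the "middle"
  small points (`|x|² ≤ |a₆|`; on `E_q` the component of order `2` of
  `E_q(K)/E_{q,0}(K) ≅ ℤ/v(q)ℤ`, Silverman, *ATAEC*, V.4 Lemma 4.1.4, Cor. IV.9.2(d)) carry no
  odd torsion class; for even `n` they do, but `2P ∈ E₀` for them
  (`TateForm.not_isSmall_two_nsmul_of_middle`), so doubling kills their classes.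
* `WeierstrassCurve.exists_not_forall_inertia_smul_eq_prime_pow_of_one_lt_j` — for an elliptic
  curve `E` over a number field, a place `v` with `|j(E)|_v > 1` and a prime `ℓ` with `v ∤ ℓ`,
  **some element of the inertia group `I_𝔐 ≤ Γ_{K_v}` moves some `ℓᵏ`-torsion point of
  `E(K̄_v)`** (`k = 2N + 4`, `|1/j|_v = |ϖ|_vᴺ`): otherwise the doubles of `E[ℓᵏ]` on the Tate
  form of invariant `j`, which contain `E[ℓᵏ⁻¹]` (`E(K̄_v)` is `2`-divisible,
  `zsmul_geomPoints_surjective_holds`; `exists_two_nsmul_eq_of_prime_pow`), would number at most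
  `ℓᵏ(2N + 1)` against `#E[ℓᵏ⁻¹] = ℓ²ᵏ⁻²` (Cor. III.6.4(b)).

## References

* J. H. Silverman, *The Arithmetic of Elliptic Curves*, 2nd ed., GTM 106, Springer 2009:
  Thm. VII.7.1 and its proof (PDF pp. 178–179), Prop. VII.5.5, Thm. VII.6.1, Cor. III.6.4(b),
  proof of Prop. III.1.4(c). [SilvermanAEC2009]
* J. H. Silverman, *Advanced Topics in the Arithmetic of Elliptic Curves*, GTM 151, Springer
  1994: V.3 Thm. 3.1, V.4 Lemmas 4.1.1–4.1.4 (PDF pp. 402–405), Cor. IV.9.2(d). [SilvermanATAEC1994]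
* J. Neukirch, *Algebraic Number Theory*, Springer 1999, Ch. II (7.5), (9.11) (value group and
  fixed field of the inertia group). [NeukirchANT1999]

## Design

Theorems only; `noncomputable section`, `open scoped Classical NNReal`, one universe `u`; the
spectral valuation is quantified with its defining property `hw` as in `SelmerFiniteProofs`.  The
proofs follow `TateForm.ncard_le_of_torsion` and `exists_not_forall_inertia_smul_eq_of_one_lt_j`
line by line.
-/

noncomputable section

open scoped Classical NNReal

universe u

namespace Literature.NumberTheory.EllipticCurves

namespace TateForm

open _root_.WeierstrassCurve

section ClassBound

variable {L : Type u} [Field L] {w : Valuation L ℝ≥0} {M : WeierstrassCurve w.integer}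
  (hT : IsTateForm w (M.baseChange L)) {n : ℕ} (hn : w n = 1)
  (G : AddSubgroup (M.baseChange L).toAffine.Point) (hG : ∀ P ∈ G, n • P = 0)
include hT hn hG

/-- **The torsion class bound for the doubles, any exponent.** Let `M_L` be in Tate form with
`|a₆| = cᴺ` for some `0 < c < 1`, let `n` be a natural number with `|n| = 1` (no parity
assumption), and let `G` be a finite `n`-torsion subgroup of `M(L)` all of whose small points
`(x, y)` with `|x|² > |a₆|` have `|x| = cᵐ` for some `m ≥ 1` ("integral levels"). Then the set of
doubles `{2P : P ∈ G}` has at most `n(2N + 1)` elements. Compared with `ncard_le_of_torsion` (odd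
`n`, bound on `#G` itself) the "middle" small points (`|x|² ≤ |a₆|`; on `E_q` the component of
order `2` of `E_q(K)/E_{q,0}(K) ≅ ℤ/v(q)ℤ`) can no longer be excluded, but they satisfy `2P ∈ E₀`
(`TateForm.not_isSmall_two_nsmul_of_middle`), so the level-and-branch map
`G → {E₀ or middle} ⊔ {1, …, N} × {0, 1}` has the property that two points with the same image
have doubles differing by a point of `G ∩ E₀`, a set with at most `n` elements
(`ncard_hasNonsingularReduction_le`). This is the elementary form of
`2·(G/(G ∩ E₀)) ↪ 2·(E(K)/E₀(K)) ≅ 2ℤ/v(Δ)ℤ` at a place of split multiplicative reduction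
(Silverman, *ATAEC*, Cor. IV.9.2(d); *AEC* Thm. VII.6.1), as used in the proof of the criterion of
Néron–Ogg–Shafarevich (*AEC* Thm. VII.7.1) — here for prime-power torsion of any prime, in
particular `2`-power torsion. [cite: SilvermanAEC2009, Thm. VII.7.1 (proof) with Thm. VII.6.1]
[cite: SilvermanATAEC1994, Cor. IV.9.2(d) and V.4 Lemma 4.1.4] -/
theorem ncard_image_two_nsmul_le_of_torsion
    (hGfin : (G : Set (M.baseChange L).toAffine.Point).Finite) {c : ℝ≥0}
    (hc0 : 0 < c) (hc1 : c < 1) {N : ℕ} (hN : w (M.baseChange L).a₆ = c ^ N)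
    (hlev : ∀ {x y : L} (h : (M.baseChange L).toAffine.Nonsingular x y),
      Affine.Point.some x y h ∈ G → w x < 1 → w (M.baseChange L).a₆ < w x ^ 2 →
        ∃ m : ℕ, 1 ≤ m ∧ w x = c ^ m) :
    ((fun P ↦ P + P) '' (G : Set (M.baseChange L).toAffine.Point)).ncard ≤ n * (2 * N + 1) := by
  have hv := Valuation.integer.integers w
  have ha₆ : (M.baseChange L).a₆ ≠ 0 := by
    rw [← (Valuation.ne_zero_iff w), hN]
    exact pow_ne_zero _ hc0.ne'
  -- the level-and-branch map (middle points and points of `E₀` go to `none`)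
  let lev : (M.baseChange L).toAffine.Point → Option (ℕ × Bool) := fun P =>
    match P with
    | .zero => none
    | .some x y _ =>
        if w x < 1 ∧ w (M.baseChange L).a₆ < w x ^ 2 then
          some (if hm : ∃ m : ℕ, 1 ≤ m ∧ w x = c ^ m then hm.choose else 0, decide (w y < w x))
        else none
  -- (1) a point of level `none` has its double in `E₀`
  have hnone : ∀ P ∈ G, lev P = none → M.HasNonsingularReduction (P + P) := by
    intro P hP hlP
    rcases P with _ | ⟨x, y, h⟩
    · rw [← Affine.Point.zero_def, add_zero]
      exact WeierstrassCurve.hasNonsingularReduction_zero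
    · by_cases hx : w x < 1
      · have hmid : ¬ w (M.baseChange L).a₆ < w x ^ 2 := by
          intro hmid
          simp only [lev, hx, hmid, and_self, if_true] at hlP
          exact Option.some_ne_none _ hlP
        rw [not_lt] at hmid
        have h2 := not_isSmall_two_nsmul_of_middle hT ha₆ h hx hmid
        rwa [isSmall_iff_not_hasNonsingularReduction hT, not_not] at h2
      · have hP₀ : M.HasNonsingularReduction (Affine.Point.some x y h) := by
          rw [← not_not (a := M.HasNonsingularReduction _),
            ← isSmall_iff_not_hasNonsingularReduction hT, isSmall_some]
          exact hx
        exact (M.nonsingularReductionSubgroup hv).add_mem hP₀ hP₀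
  -- (2) two points of `G` with the same level have doubles differing by a point of `E₀`
  have hcongr : ∀ P ∈ G, ∀ Q ∈ G, lev P = lev Q →
      M.HasNonsingularReduction (P + P - (Q + Q)) := by
    intro P hP Q hQ hPQ
    by_cases hlP : lev P = none
    · have hlQ : lev Q = none := hPQ ▸ hlP
      exact (M.nonsingularReductionSubgroup hv).sub_mem (hnone P hP hlP) (hnone Q hQ hlQ)
    · have hlQ : lev Q ≠ none := hPQ ▸ hlP
      rcases P with _ | ⟨x₁, y₁, h₁⟩
      · simp [lev] at hlP
      rcases Q with _ | ⟨x₂, y₂, h₂⟩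
      · simp [lev] at hlQ
      have hc₁ : w x₁ < 1 ∧ w (M.baseChange L).a₆ < w x₁ ^ 2 := by
        by_contra hc
        apply hlP
        simp only [lev, hc, if_false]
      have hc₂ : w x₂ < 1 ∧ w (M.baseChange L).a₆ < w x₂ ^ 2 := by
        by_contra hc
        apply hlQ
        simp only [lev, hc, if_false]
      have ex₁ := hlev h₁ hP hc₁.1 hc₁.2
      have ex₂ := hlev h₂ hQ hc₂.1 hc₂.2
      simp only [lev, hc₁, hc₂, and_self, if_true, dif_pos ex₁, dif_pos ex₂, Option.some.injEq,
        Prod.mk.injEq, decide_eq_decide] at hPQ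
      obtain ⟨hm, hb⟩ := hPQ
      have hx : w x₁ = w x₂ := by rw [ex₁.choose_spec.2, ex₂.choose_spec.2, hm]
      have hsub : M.HasNonsingularReduction (Affine.Point.some x₁ y₁ h₁ - .some x₂ y₂ h₂) := by
        rw [← not_not (a := M.HasNonsingularReduction _),
          ← isSmall_iff_not_hasNonsingularReduction hT]
        by_cases hb₁ : w y₁ < w x₁
        · exact not_isSmall_sub_of_branch₀ hT h₁ h₂ hx hc₁.1 hb₁ (hb.mp hb₁)
        · have hb₂ : ¬ w y₂ < w x₂ := fun h' => hb₁ (hb.mpr h')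
          have hd₁ : w (y₁ + x₁) < w x₁ :=
            ((branch hT h₁.1 hc₁.1 hc₁.2).resolve_left fun h' => hb₁ h'.1).1
          have hd₂ : w (y₂ + x₂) < w x₂ :=
            ((branch hT h₂.1 hc₂.1 hc₂.2).resolve_left fun h' => hb₂ h'.1).1
          exact not_isSmall_sub_of_branch₁ hT h₁ h₂ hx hc₁.1 hd₁ hd₂
      have e : Affine.Point.some x₁ y₁ h₁ + .some x₁ y₁ h₁ - (.some x₂ y₂ h₂ + .some x₂ y₂ h₂) =
          (Affine.Point.some x₁ y₁ h₁ - .some x₂ y₂ h₂) + (.some x₁ y₁ h₁ - .some x₂ y₂ h₂) := by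
        abel
      rw [e]
      exact (M.nonsingularReductionSubgroup hv).add_mem hsub hsub
  -- (3) levels lie in `{none} ∪ {1, …, N} × Bool`
  have himage : ∀ P ∈ G, lev P ∈ insert none
      ((Finset.Icc 1 N ×ˢ (Finset.univ : Finset Bool)).image some) := by
    intro P hP
    rcases P with _ | ⟨x, y, h⟩
    · exact Finset.mem_insert_self _ _
    · by_cases hx : w x < 1 ∧ w (M.baseChange L).a₆ < w x ^ 2
      · have ex := hlev h hP hx.1 hx.2
        simp only [lev, hx, and_self, if_true, dif_pos ex]
        refine Finset.mem_insert_of_mem (Finset.mem_image_of_mem _ (Finset.mem_product.mpr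
          ⟨Finset.mem_Icc.mpr ⟨ex.choose_spec.1, ?_⟩, Finset.mem_univ _⟩))
        -- `c^N = |a₆| < |x|² = c^(2m)` forces `2m < N`
        have hlt : c ^ N < c ^ (2 * ex.choose) := by
          rw [← hN, mul_comm, pow_mul, ← ex.choose_spec.2]
          exact hx.2
        have := (pow_lt_pow_iff_right_of_lt_one₀ hc0 hc1).mp hlt
        omega
      · simp only [lev, hx, if_false]
        exact Finset.mem_insert_self _ _
  -- counting
  set s := hGfin.toFinset with hs
  have hsG : ∀ P, P ∈ s ↔ P ∈ G := fun P => by simp [hs]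
  have hHfin : ({P | P ∈ G ∧ M.HasNonsingularReduction P} : Set _).Finite :=
    hGfin.subset fun P hP => hP.1
  set dbl : (M.baseChange L).toAffine.Point → (M.baseChange L).toAffine.Point := fun P ↦ P + P
    with hdbl
  have hfib : ∀ b ∈ s.image lev, ((s.filter (fun P => lev P = b)).image dbl).card ≤ n := by
    intro b hb
    obtain ⟨Q₀, hQ₀s, rfl⟩ := Finset.mem_image.mp hb
    have hQ₀ : Q₀ ∈ G := (hsG Q₀).mp hQ₀s
    refine le_trans ?_ (ncard_hasNonsingularReduction_le hT hn G hG)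
    rw [Set.ncard_eq_toFinset_card _ hHfin]
    refine Finset.card_le_card_of_injOn (fun R => R - (Q₀ + Q₀)) ?_ ?_
    · intro R hR
      rw [Finset.mem_coe, Finset.mem_image] at hR
      obtain ⟨P, hP, rfl⟩ := hR
      rw [Finset.mem_filter] at hP
      rw [Finset.mem_coe, Set.Finite.mem_toFinset]
      have hPG : P ∈ G := (hsG P).mp hP.1
      exact ⟨G.sub_mem (G.add_mem hPG hPG) (G.add_mem hQ₀ hQ₀), hcongr P hPG Q₀ hQ₀ hP.2⟩
    · intro R _ R' _ hRR'
      exact sub_left_injective hRR'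
  have himg : (s.image lev).card ≤ 2 * N + 1 := by
    calc (s.image lev).card
        ≤ (insert none ((Finset.Icc 1 N ×ˢ (Finset.univ : Finset Bool)).image some)).card := by
          refine Finset.card_le_card fun b hb => ?_
          obtain ⟨P, hPs, rfl⟩ := Finset.mem_image.mp hb
          exact himage P ((hsG P).mp hPs)
      _ ≤ ((Finset.Icc 1 N ×ˢ (Finset.univ : Finset Bool)).image some).card + 1 :=
          Finset.card_insert_le _ _
      _ ≤ (Finset.Icc 1 N ×ˢ (Finset.univ : Finset Bool)).card + 1 := by
          gcongr; exact Finset.card_image_le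
      _ = 2 * N + 1 := by
          rw [Finset.card_product, Nat.card_Icc, Finset.card_univ, Fintype.card_bool]
          omega
  have hcover : s.image dbl ⊆
      (s.image lev).biUnion (fun b => (s.filter (fun P => lev P = b)).image dbl) := by
    intro R hR
    obtain ⟨P, hPs, rfl⟩ := Finset.mem_image.mp hR
    exact Finset.mem_biUnion.mpr ⟨lev P, Finset.mem_image_of_mem _ hPs,
      Finset.mem_image_of_mem _ (Finset.mem_filter.mpr ⟨hPs, rfl⟩)⟩
  have hset : (dbl '' (G : Set (M.baseChange L).toAffine.Point)) = ((s.image dbl : Finset _) :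
      Set (M.baseChange L).toAffine.Point) := by
    rw [Finset.coe_image, hs, Set.Finite.coe_toFinset]
  calc (dbl '' (G : Set (M.baseChange L).toAffine.Point)).ncard = (s.image dbl).card := by
        rw [hset, Set.ncard_coe_finset]
    _ ≤ ((s.image lev).biUnion (fun b => (s.filter (fun P => lev P = b)).image dbl)).card :=
        Finset.card_le_card hcover
    _ ≤ ∑ b ∈ s.image lev, ((s.filter (fun P => lev P = b)).image dbl).card :=
        Finset.card_biUnion_le
    _ ≤ ∑ _b ∈ s.image lev, n := Finset.sum_le_sum hfib
    _ = (s.image lev).card * n := by rw [Finset.sum_const, smul_eq_mul]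
    _ ≤ (2 * N + 1) * n := Nat.mul_le_mul_right n himg
    _ = n * (2 * N + 1) := mul_comm _ _

end ClassBound

end TateForm

end Literature.NumberTheory.EllipticCurves


/-! ## Prime-power torsion at a place with `|j|_v > 1` is ramified -/

namespace WeierstrassCurve

open Literature.NumberTheory.EllipticCurves Literature.NumberTheory.GaloisRepresentations
  IsDedekindDomain.HeightOneSpectrum NumberField IsDedekindDomain Field

variable {K : Type u} [Field K] [NumberField K] (W : WeierstrassCurve K) {v : HeightOneSpectrum (𝓞 K)}
  {w : Valuation (AlgebraicClosure (v.adicCompletion K)) ℝ≥0}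
  (hw : ∀ x, (w x : ℝ) = spectralNorm (v.adicCompletion K) (AlgebraicClosure (v.adicCompletion K)) x)

/-- In an abelian group, an `ℓᵏ`-torsion element is the double of an `ℓᵏ⁺¹`-torsion element, for
any prime `ℓ`, as soon as it is the double of something: if `2P₀ = Q`, `ℓᵏQ = 0`, then
`T = ℓᵏP₀` is `2`-torsion, and `P = P₀` (`ℓ = 2`) resp. `P = P₀ + T` (`ℓ` odd, so that
`ℓᵏT = T`) works. [folklore] -/
theorem _root_.Literature.NumberTheory.EllipticCurves.exists_two_nsmul_eq_of_prime_pow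
    {A : Type*} [AddCommGroup A] {ℓ : ℕ} (hℓ : ℓ.Prime) {k : ℕ} {Q P₀ : A} (hQ : ℓ ^ k • Q = 0)
    (hP₀ : 2 • P₀ = Q) : ∃ P : A, 2 • P = Q ∧ ℓ ^ (k + 1) • P = 0 := by
  set T := ℓ ^ k • P₀ with hT
  have h2T : 2 • T = 0 := by rw [hT, ← mul_nsmul', mul_comm, mul_nsmul', hP₀, hQ]
  rcases hℓ.eq_two_or_odd' with rfl | hodd
  · exact ⟨P₀, hP₀, by rw [pow_succ, mul_comm, mul_nsmul', ← hT, h2T]⟩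
  · obtain ⟨m, hm⟩ : Odd (ℓ ^ k) := hodd.pow
    have hkT : ℓ ^ k • T = T := by
      rw [hm, add_nsmul, one_nsmul, mul_comm 2 m, mul_nsmul', h2T, nsmul_zero, zero_add]
    refine ⟨P₀ + T, by rw [nsmul_add, hP₀, h2T, add_zero], ?_⟩
    rw [pow_succ, mul_comm, mul_nsmul', nsmul_add, ← hT, hkT, ← two_nsmul, h2T, nsmul_zero]

include hw in
/-- **Potentially multiplicative reduction forces ramified `ℓ`-power torsion, for every prime
`ℓ ∤ v` — including `ℓ = 2`.** Let `E` be an elliptic curve over a number field `K`, `v` a finite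
place with `|j(E)|_v > 1`, `𝔐` the prime of the local absolute integers `\bar 𝓞_v ⊆ K̄_v` with
inertia group `I_𝔐 ≤ Γ_{K_v}`, and `ℓ` a prime with `v ∤ ℓ`. Then for some `k` the inertia group
does **not** fix the `ℓᵏ`-torsion of `E(K̄_v)`. (Silverman, *AEC*, Thm. VII.7.1, the case of
multiplicative reduction in the proof of (d) ⇒ (a), PDF p. 179, with Prop. VII.5.5; the odd case
is `exists_not_forall_inertia_smul_eq_of_one_lt_j`. Proof for all `ℓ` at once: if `I_𝔐` fixed
`E[ℓᵏ⁺¹]`, `k = 2N + 3`, `|1/j|_v = |ϖ|_vᴺ`, then on the Tate form of invariant `j` the doubles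
of `E[ℓᵏ⁺¹]`, which contain `E[ℓᵏ]` (`exists_two_nsmul_eq_of_prime_pow`, `E(K̄_v)` being
`2`-divisible), would number at most `ℓᵏ⁺¹(2N + 1)` by the class bound for doubles
(`TateForm.ncard_image_two_nsmul_le_of_torsion`), against `#E[ℓᵏ] = ℓ²ᵏ` (Cor. III.6.4(b)):
`ℓᵏ⁻¹ ≤ 2N + 1` is false.)
[cite: SilvermanAEC2009, Thm. VII.7.1 (proof, multiplicative case) with Prop. VII.5.5 and Cor. III.6.4(b)] -/
theorem exists_not_forall_inertia_smul_eq_prime_pow_of_one_lt_j [W.IsElliptic]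
    {𝔐 : Ideal v.localAbsIntegers} (h𝔐 : 𝔐 ∈ v.localPrimesAbove)
    (hj : 1 < w (algebraMap K (AlgebraicClosure (v.adicCompletion K)) W.j))
    {ℓ : ℕ} (hℓ : ℓ.Prime) (hℓv : (ℓ : 𝓞 K) ∉ v.asIdeal) :
    ∃ k : ℕ, ¬ ∀ σ ∈ 𝔐.inertia (absoluteGaloisGroup (v.adicCompletion K)),
        ∀ P : localPoints W (v.adicCompletion K), ℓ ^ k • P = 0 → σ • P = P := by
  set Kv := v.adicCompletion K with hKv
  set L := AlgebraicClosure Kv with hL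
  set f := algebraMap Kv L with hf
  set jv : Kv := algebraMap K Kv W.j with hjv
  obtain ⟨hj0, hj1728, hT, ha₆0, ha₆pos, ha₆lt⟩ := W.isTateForm_tateFormOfJ_of_one_lt hj
  haveI hTell : (tateFormOfJ jv).IsElliptic := isElliptic_tateFormOfJ hj0 hj1728
  set T := tateFormOfJ jv with hTdef
  -- a uniformiser, `c = |ϖ|_v`, and `N` with `|a₆|_v = c ^ N`
  obtain ⟨ϖ, hϖ⟩ := IsDiscreteValuationRing.exists_irreducible (v.adicCompletionIntegers K)
  obtain ⟨hc0, hc1⟩ := spectralValuation_uniformizer_pos_lt_one hw hϖ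
  set c := w (f (ϖ : Kv)) with hc
  have ha₆K : (T.baseChange L).a₆ = f T.a₆ := rfl
  obtain ⟨N, -, hN⟩ := exists_spectralValuation_algebraMap_eq_pow hw hϖ (a := T.a₆)
    (by rw [← ha₆K]; exact ha₆pos) (by rw [← ha₆K]; exact ha₆lt)
  -- `k = 2N + 3`; suppose `I_𝔐` fixes `E[ℓ^(k+1)]`
  refine ⟨2 * N + 3 + 1, fun hfix => ?_⟩
  set k : ℕ := 2 * N + 3 with hk
  set n : ℕ := ℓ ^ (k + 1) with hndef
  have hℓ1 : 1 < ℓ := hℓ.one_lt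
  have hn0 : 0 < n := pow_pos hℓ.pos _
  have hnv : (n : 𝓞 K) ∉ v.asIdeal := by
    rw [hndef, Nat.cast_pow]
    exact fun h ↦ hℓv (v.isPrime.mem_of_pow_mem _ h)
  have hwn : w (n : L) = 1 := by
    have := spectralValuation_intCast_eq_one hw (n := (n : ℤ)) (by exact_mod_cast hnv)
    exact_mod_cast this
  -- the `𝒪_w`-model `M` of `T_L`
  have ha₄le : w (T.baseChange L).a₄ ≤ 1 := hT.w_a₄_le.trans ha₆lt.le
  set M : WeierstrassCurve w.integer :=
    ⟨1, 0, 0, ⟨(T.baseChange L).a₄, ha₄le⟩, ⟨(T.baseChange L).a₆, ha₆lt.le⟩⟩ with hMdef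
  have hM : M.baseChange L = T.baseChange L := by
    ext
    · change ((1 : w.integer) : L) = _
      rw [hT.a₁]; rfl
    · change ((0 : w.integer) : L) = _
      rw [hT.a₂]; rfl
    · change ((0 : w.integer) : L) = _
      rw [hT.a₃]; rfl
    · rfl
    · rfl
  have hT' : TateForm.IsTateForm w (M.baseChange L) := by rw [hM]; exact hT
  have hMa₆ : (M.baseChange L).a₆ = (T.baseChange L).a₆ := rfl
  -- the `x`-affine isomorphism `E(K̄_v) ≃ T(K̄_v)` and the transport to `M(K̄_v)`
  have hjW : (W.baseChange Kv).j = jv := W.map_j (algebraMap K Kv)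
  have hjT : (W.baseChange Kv).j = T.j := hjW.trans (tateFormOfJ_j hj0 hj1728).symm
  haveI : CharZero Kv := charZero_of_injective_algebraMap (algebraMap K Kv).injective
  haveI : CharZero L := charZero_of_injective_algebraMap (algebraMap K L).injective
  obtain ⟨e, α, β, he⟩ := exists_addEquiv_baseChange_x_affine_of_j_eq (W.baseChange Kv) T L hjT
    (by rw [hjW]; exact hj0) (by rw [hjW]; exact hj1728)
  set eW := Affine.Point.congrEquiv (W.baseChange_baseChange_adicCompletion v).symm with heW
  set e₀ := Affine.Point.congrEquiv hM.symm with he₀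
  set E : localPoints W Kv ≃+ (M.baseChange L).toAffine.Point := eW.trans (e.trans e₀) with hE
  -- the `n`-torsion `G` of `M(K̄_v)`, `n = ℓ^(k+1)`, and its cardinality `n²`
  set G := AddSubgroup.torsionBy (M.baseChange L).toAffine.Point (n : ℤ) with hG
  have hGmem : ∀ P, P ∈ G ↔ (n : ℤ) • P = 0 := fun P =>
    Submodule.mem_torsionBy_iff _ _
  have hGn : ∀ P ∈ G, n • P = 0 := fun P hP => by
    rw [← natCast_zsmul]; exact (hGmem P).mp hP
  have hcardG : Nat.card G = n ^ 2 := by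
    rw [hG, ← E.natCard_torsionBy_eq (n : ℤ)]
    exact W.card_torsionPoints_eq_sq_holds L (n := n) (by exact_mod_cast hn0.ne')
  have hGfin : (G : Set (M.baseChange L).toAffine.Point).Finite := by
    haveI : Finite G := Nat.finite_of_card_ne_zero (by rw [hcardG]; positivity)
    exact Set.toFinite _
  -- the `ℓ^k`-torsion `G'` and its cardinality `ℓ^(2k)`
  set G' := AddSubgroup.torsionBy (M.baseChange L).toAffine.Point ((ℓ ^ k : ℕ) : ℤ) with hG'
  have hG'mem : ∀ P, P ∈ G' ↔ ((ℓ ^ k : ℕ) : ℤ) • P = 0 := fun P =>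
    Submodule.mem_torsionBy_iff _ _
  have hcardG' : Nat.card G' = (ℓ ^ k) ^ 2 := by
    rw [hG', ← E.natCard_torsionBy_eq ((ℓ ^ k : ℕ) : ℤ)]
    exact W.card_torsionPoints_eq_sq_holds L (n := ℓ ^ k)
      (by exact_mod_cast (pow_pos hℓ.pos k).ne')
  -- the levels of the points of `G` are integral: their abscissae lie in `K_v^nr`
  have hlev : ∀ {x y : L} (h : (M.baseChange L).toAffine.Nonsingular x y),
      Affine.Point.some x y h ∈ G → w x < 1 → w (M.baseChange L).a₆ < w x ^ 2 →
        ∃ m : ℕ, 1 ≤ m ∧ w x = c ^ m := by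
    intro x y h hP hx hmid
    have hx0 : 0 < w x := TateForm.w_x_pos_of_lt_sq hmid
    refine exists_spectralValuation_eq_pow_of_forall_inertia hw h𝔐 hϖ (fun σ hσ => ?_) hx0 hx
    set P : (M.baseChange L).toAffine.Point := Affine.Point.some x y h with hPdef
    set Q := E.symm P with hQ
    have hQn : ℓ ^ (k + 1) • Q = 0 := by rw [hQ, ← map_nsmul, ← hndef, hGn P hP, map_zero]
    have hσQ : σ • Q = Q := hfix σ hσ Q hQn
    have hEQ : E Q = P := E.apply_symm_apply P
    rcases hQ' : Q with _ | ⟨xq, yq, hq⟩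
    · exfalso
      rw [hQ'] at hEQ
      exact Affine.Point.some_ne_zero h (hEQ.symm.trans (map_zero E))
    · -- `σ` fixes `xq`
      have hσx : absoluteGaloisGroup.toAlgEquiv Kv σ xq = xq := by
        rw [hQ', localPoints.smul_def] at hσQ
        change Affine.Point.map _ (Affine.Point.some xq yq hq) = _ at hσQ
        rw [Affine.Point.map_some, Affine.Point.some.injEq] at hσQ
        exact hσQ.1
      -- `x = α xq + β`
      obtain ⟨x', y', h', hex', hx'⟩ := he xq yq ((W.baseChange_baseChange_adicCompletion v) ▸ hq)
      have hEQ' : e₀ (e (eW (Affine.Point.some xq yq hq))) = P := by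
        rw [← hEQ, hQ']
        rfl
      have hPx : x = f α * xq + f β := by
        rw [heW, Affine.Point.congrEquiv_some, hex', he₀, Affine.Point.congrEquiv_some, hPdef,
          Affine.Point.some.injEq] at hEQ'
        rw [← hEQ'.1, hx']
      rw [hPx, map_add, map_mul, AlgEquiv.commutes, AlgEquiv.commutes, hσx]
  -- the class bound for the doubles of `G` ...
  have hbound := TateForm.ncard_image_two_nsmul_le_of_torsion hT' hwn G hGn hGfin hc0 hc1
    (hMa₆ ▸ ha₆K ▸ hN) hlev
  -- ... which contain `G'` (`E(K̄_v)` is `2`-divisible)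
  have hsub : (G' : Set (M.baseChange L).toAffine.Point) ⊆
      (fun P ↦ P + P) '' (G : Set (M.baseChange L).toAffine.Point) := by
    intro Q hQ
    have hQk : ℓ ^ k • Q = 0 := by
      rw [← natCast_zsmul]; exact (hG'mem Q).mp hQ
    -- `2`-divisibility, transported from `E_{K_v}(K̄_v)`
    obtain ⟨R₀, hR₀⟩ := (W.baseChange Kv).zsmul_geomPoints_surjective_holds (n := (2 : ℤ))
      two_ne_zero (eW (E.symm Q))
    have hR₀' : @HSMul.hSMul ℕ ((W.baseChange Kv).baseChange L).toAffine.Point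
        ((W.baseChange Kv).baseChange L).toAffine.Point instHSMul 2 R₀ = eW (E.symm Q) := by
      have h : (2 : ℤ) • R₀ = eW (E.symm Q) := hR₀
      rw [← natCast_zsmul]
      exact h
    set P₀ : (M.baseChange L).toAffine.Point := e₀ (e R₀) with hP₀
    have h2P₀ : 2 • P₀ = Q := by
      rw [hP₀, ← map_nsmul, ← map_nsmul, hR₀']
      change E (E.symm Q) = Q
      exact E.apply_symm_apply Q
    obtain ⟨P, h2P, hPn⟩ := exists_two_nsmul_eq_of_prime_pow hℓ hQk h2P₀
    refine ⟨P, ?_, show P + P = Q by rw [← two_nsmul, h2P]⟩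
    change P ∈ G
    rw [hGmem, natCast_zsmul, hndef]
    exact hPn
  have hfinS : ((fun P ↦ P + P) '' (G : Set (M.baseChange L).toAffine.Point)).Finite :=
    hGfin.image _
  have hle : (ℓ ^ k) ^ 2 ≤ n * (2 * N + 1) := by
    calc (ℓ ^ k) ^ 2 = Nat.card G' := hcardG'.symm
      _ = (G' : Set (M.baseChange L).toAffine.Point).ncard := (Nat.card_coe_set_eq _).symm
      _ ≤ ((fun P ↦ P + P) '' (G : Set (M.baseChange L).toAffine.Point)).ncard :=
          Set.ncard_le_ncard hsub hfinS
      _ ≤ n * (2 * N + 1) := hbound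
  -- `ℓ^(2k) ≤ ℓ^(k+1) (2N+1)` forces `ℓ^(k-1) ≤ 2N + 1`, impossible for `k = 2N + 3`
  have hle' : ℓ ^ (k + 1) * ℓ ^ (k - 1) ≤ ℓ ^ (k + 1) * (2 * N + 1) := by
    rw [← pow_add, show k + 1 + (k - 1) = k * 2 by omega, pow_mul]
    exact hle
  have hle'' : ℓ ^ (k - 1) ≤ 2 * N + 1 := Nat.le_of_mul_le_mul_left hle' (pow_pos hℓ.pos _)
  have hlt : 2 * N + 2 < 2 ^ (k - 1) := by
    rw [show k - 1 = 2 * N + 2 by omega]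
    exact Nat.lt_two_pow_self
  have hmono : 2 ^ (k - 1) ≤ ℓ ^ (k - 1) := Nat.pow_le_pow_left hℓ.two_le _
  omega

end WeierstrassCurve



end
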